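import Literature.Barriers.BirchSwinnertonDyer.DescentDefectUnbounded
import Literature.NumberTheory.EllipticCurves.PeriodIndexSupport
import Literature.NumberTheory.EllipticCurves.PeriodIndexLangTateProofs
import Literature.NumberTheory.EllipticCurves.PeriodIndexRationalDivisor
import HarnessLib

/-!
# Barrier (BirchSwinnertonDyer): `ClarkSharif2010_thm3` — reduction to the printed parts

`Proofs` companion of `Literature/Barriers/BirchSwinnertonDyer/DescentDefectUnbounded.lean` for
its named fact `Literature.Barriers.BirchSwinnertonDyer.ClarkSharif2010_thm3` (P. L. Clark,
S. Sharif, *Period, index and potential. III*, Algebra Number Theory 4 (2010) 151–174,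
arXiv:0811.3019, **Theorem 3**, p. 3 of the arXiv text: "For any positive integer `r`, there
exists a degree `P` field extension `L/K` such that `Ш(L, E)` contains at least `r` elements of
order `P`"; vendored over `K = ℚ`).

The printed proof (§3.7, p. 13) deduces Theorem 3 from Theorem 2 of the paper, Lang–Tate's
splitting criterion for torsors under a good-reduction curve over a local field, Cassels'
`I = P` on `Ш`, the existence of a degree-`P` extension with prescribed totally ramified
completions, and the finiteness of supports. That deduction is formalised, over an arbitrary
number field `K`, in `Literature/NumberTheory/EllipticCurves/PeriodIndex`
(`Literature.NumberTheory.EllipticCurves.ClarkSharif2010_thm3_of_parts`), where the five parts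
are vendored as named facts; the ramified-extension part is PROVED in
`Literature/NumberTheory/EllipticCurves/PeriodIndexRamifiedExtension` and discharged in
`Literature/NumberTheory/EllipticCurves/PeriodIndexProofs`
(`ClarkSharif2010_exists_totallyRamified_holds`, `ClarkSharif2010_thm3_of_parts'`).

This file closes the last, purely formal, step: the specialisation `K = ℚ` of
`ClarkSharif2010_thm3_of_parts'` IS the barrier-catalogue statement `ClarkSharif2010_thm3`
(`ClarkSharif2010_thm3_of_parts`). The only point is that the number-field theorem produces
`L` with SOME `ℚ`-algebra structure, while the barrier statement reads `[L : ℚ]` and `E_L`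
through the canonical one (`DivisionRing.toRatAlgebra`); the two agree because
`Algebra ℚ L` is a subsingleton (Mathlib `algebra_rat_subsingleton`).

So `ClarkSharif2010_thm3` rests on exactly four named facts of
`Literature.NumberTheory.EllipticCurves` (universe `0` instances):
`ClarkSharif2010_thm2` (Theorem 2 of the paper), `LangTate1958_split_of_dvd_ramificationIdx`,
`Cassels1962_index_eq_period_of_mem_sha`, `finite_support` (`ClarkSharif2010_thm3_of_parts`);
and, since `Literature/NumberTheory/EllipticCurves/PeriodIndexSupport` derives `finite_support`
from Milne, *Arithmetic Duality Theorems*, Prop. I.3.8 (`H¹(G/I, A(K^un)) = 0` at good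
reduction; `Literature.NumberTheory.EllipticCurves.finite_support_of_unramifiedClass_eq_zero`),
equally on `ClarkSharif2010_thm2`, `LangTate1958_split_of_dvd_ramificationIdx`,
`Cassels1962_index_eq_period_of_mem_sha` and `Milne2006_unramifiedClass_eq_zero`
(`ClarkSharif2010_thm3_of_parts'`) — four classical printed theorems, none of which is within
reach of Mathlib or the tree at present (local Tate duality and O'Neil's period-index
obstruction, tame local Galois cohomology of abelian varieties, the Hasse principle for Brauer
groups, Lang's theorem with Hensel lifting on Néron models).

Update (review of the fact, 2026-08-15). Two of these four parts have since been DISCHARGED in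
the tree: `Literature.NumberTheory.EllipticCurves.Milne2006_unramifiedClass_eq_zero_holds` and
`Literature.NumberTheory.EllipticCurves.finite_support_holds` (`PeriodIndexSupportProofs`: Milne
ADT I.3.8 by Lang's theorem on the special fibre and successive approximation over the unramified
layers), and `Literature.NumberTheory.EllipticCurves.LangTate1958_split_of_dvd_ramificationIdx_holds`
(`PeriodIndexLangTateProofs`, through the local form `LangTate1958_cor1_local_holds` of
`LocalH1TateDualityLangTateProofs`). Feeding them in, `ClarkSharif2010_thm3` rests on exactly TWO
named facts (`ClarkSharif2010_thm3_of_thm2_of_cassels`): `ClarkSharif2010_thm2` — Theorem 2 of the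
paper, reduced in `PeriodIndexThm2Reduction` (`ClarkSharif2010_thm2_of_kummerClasses`) to `I ∣ P²`
and the index-`P²` property of the corestricted Kummer classes `cores_{K_P/K} Φ(a_i, b_i)`
(§§3.4–3.6: O'Neil's period-index obstruction map, Lichtenbaum–Tate duality, Hilbert symbols, the
Hasse principle for `Br K`) — and `Cassels1962_index_eq_period_of_mem_sha`, reduced in
`PeriodIndexCassels` to its hard half `I ∣ P` on `Ш` (`Cassels1962_index_eq_period_of_mem_sha_of_index_dvd`,
`…_of_selmer_isPrimePow`: the reciprocity law for the Brauer group of a number field). The statement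
`ClarkSharif2010_thm3` itself was re-read against the arXiv text (Theorem 3, p. 3, with the
conventions of §1.1: `K` a global field, `P` a positive integer prime to the characteristic; §3.7,
p. 13) and is the printed theorem verbatim at `K = ℚ`, `P > 1`.

Update (squarefree `P`, 2026-08-15). Cassels' theorem enters §3.7 at ONE point only: to
upgrade "`P(η_i|_L) ∣ P` and `P ∣ I(η_i|_L)`" to "`P(η_i|_L) = P`" ("by (ii) above,
`I(η_i|_L) = P(η_i|_L) ∣ P(η_i) = P`"). Everything before that point is now a theorem of the tree
given Theorem 2, and is isolated here as `ClarkSharif2010_thm3_core_of_thm2`: from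
`ClarkSharif2010_thm2` alone (with the discharged Lang–Tate criterion, finiteness of supports and
ramified degree-`P` extension), for every elliptic `E/K` over a number field, `P > 1` and `r`
there are `L/K` of degree `P` and `r` distinct NONZERO classes `x ∈ Ш(E_L/L)` with `P(x) ∣ P` and
`P ∣ I(x)`. Since the tree now also proves `I ∣ P²`
(`Literature.NumberTheory.EllipticCurves.index_dvd_addOrderOf_sq`, `PeriodIndexRationalDivisor`:
the `E[n]`-torsor of a Kummer lift is a rational divisor of degree `n²`; Clark–Sharif §1.3 (1)),
`P ∣ I(x) ∣ P(x)²`, so that **for squarefree `P` (in particular for prime `P`) `P(x) = P` without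
Cassels' theorem**: `ClarkSharif2010_thm3_numberField_of_thm2_of_squarefree`,
`ClarkSharif2010_thm3_squarefree_of_thm2` (the statement `ClarkSharif2010_thm3` restricted to
squarefree `P`, from `ClarkSharif2010_thm2` alone) and `ClarkSharif2010_thm3_prime_of_thm2`. For
general `P` the same core gives back §3.7 with (ii)
(`ClarkSharif2010_thm3_numberField_of_thm2_of_cassels`).
(For `P` divisible by a square, e.g. `P = 4`, the constraints `P(x) ∣ 4`, `4 ∣ I(x) ∣ P(x)²` do
not exclude `P(x) = 2`, `I(x) = 4` — a class of `Ш` with `I ≠ P`, which is exactly what Cassels'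
theorem forbids; so for such `P` the dependence on `Cassels1962_index_eq_period_of_mem_sha`
remains.)

## References

* P. L. Clark, S. Sharif, Algebra Number Theory 4 (2010) 151–174, Theorem 3 (p. 3) and §3.7
  (p. 13) (`ClarkSharif2010`; arXiv:0811.3019 held, pp. 1–5 and 13 read for this file).
* J. S. Milne, *Arithmetic Duality Theorems*, 2nd ed. (2006), Ch. I Prop. 3.8 (`MilneADT2006`;
  author's electronic copy read, book pp. 46–48; vendored in `PeriodIndexSupport`).
-/

noncomputable section

open scoped Classical

open WeierstrassCurve Literature.NumberTheory.EllipticCurves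

universe u

namespace Literature.Barriers.BirchSwinnertonDyer

/-- **Clark–Sharif 2010, Theorem 3 over `ℚ`, from the four remaining printed parts** (Theorem 2
of the paper, Lang–Tate's splitting criterion, Cassels' `I = P` on `Ш`, finiteness of supports —
the ramified degree-`P` extension being proved in the tree): the barrier-catalogue fact
`ClarkSharif2010_thm3` is the case `K = ℚ` of
`Literature.NumberTheory.EllipticCurves.ClarkSharif2010_thm3_of_parts'` (§3.7 of the paper,
formalised there), read through the canonical `ℚ`-algebra structure of the number field `L`
(`Subsingleton (Algebra ℚ L)`). [cite: ClarkSharif2010, Theorem 3 and §3.7] -/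
theorem ClarkSharif2010_thm3_of_parts (h2 : ClarkSharif2010_thm2.{0})
    (hLT : LangTate1958_split_of_dvd_ramificationIdx.{0})
    (hC : Cassels1962_index_eq_period_of_mem_sha.{0}) (hF : finite_support.{0}) :
    ClarkSharif2010_thm3 := by
  intro W hW P hP r
  obtain ⟨L, _, _, inst, hdeg, S, hS, hord⟩ := ClarkSharif2010_thm3_of_parts' h2 hLT hC hF W hP r
  have h : inst = DivisionRing.toRatAlgebra := Subsingleton.elim _ _
  subst h
  exact ⟨L, inferInstance, inferInstance, hdeg, S, hS, hord⟩

/-- **Clark–Sharif 2010, Theorem 3 over `ℚ`, from Theorem 2, Lang–Tate, Cassels and Milne's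
Prop. I.3.8.** The same reduction with the part "supports of classes of `H¹(K, E)` are finite"
discharged from Milne, *Arithmetic Duality Theorems*, Prop. I.3.8 (`H¹(G/I, E(K_v^un)) = 0` at a
place of good reduction, vendored as
`Literature.NumberTheory.EllipticCurves.Milne2006_unramifiedClass_eq_zero`) by
`Literature.NumberTheory.EllipticCurves.finite_support_of_unramifiedClass_eq_zero`.
[cite: ClarkSharif2010, Theorem 3 and §3.7] [cite: MilneADT2006, Ch. I Prop. 3.8] -/
theorem ClarkSharif2010_thm3_of_parts' (h2 : ClarkSharif2010_thm2.{0})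
    (hLT : LangTate1958_split_of_dvd_ramificationIdx.{0})
    (hC : Cassels1962_index_eq_period_of_mem_sha.{0})
    (hM : Milne2006_unramifiedClass_eq_zero.{0}) : ClarkSharif2010_thm3 :=
  ClarkSharif2010_thm3_of_parts h2 hLT hC (finite_support_of_unramifiedClass_eq_zero hM)

/-- **Clark–Sharif 2010, Theorem 3 over `ℚ`, from the two parts of its printed proof that remain
named facts: Theorem 2 of the paper and Cassels' `I = P` on `Ш`.** The other inputs of §3.7 are
theorems of the tree — the degree-`P` extension with prescribed totally ramified completions
(`ClarkSharif2010_exists_totallyRamified_holds`, inside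
`Literature.NumberTheory.EllipticCurves.ClarkSharif2010_thm3_of_parts'`), Lang–Tate's splitting
criterion (`LangTate1958_split_of_dvd_ramificationIdx_holds`, from Milne ADT I.3.8) and the
finiteness of supports (`finite_support_holds`, from the same). So: if Theorem 2 holds (for every
elliptic curve over a number field, a sequence `η_i ∈ H¹(K, E)`, `η_0 = 0`, locally trivial at a
prescribed finite set of places, with `η_i - η_j` of period `P` and index `P²` for `i ≠ j`) and
`I = P` on `Ш` (Cassels 1962), then for every elliptic `E/ℚ`, `P > 1` and `r` there is a number
field `L` with `[L : ℚ] = P` and `r` distinct elements of `Ш(E_L/L)` of order exactly `P`.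
[cite: ClarkSharif2010, Theorem 3 and §3.7] [cite: MilneADT2006, Ch. I Prop. 3.8] -/
theorem ClarkSharif2010_thm3_of_thm2_of_cassels (h2 : ClarkSharif2010_thm2.{0})
    (hC : Cassels1962_index_eq_period_of_mem_sha.{0}) : ClarkSharif2010_thm3 :=
  ClarkSharif2010_thm3_of_parts h2 LangTate1958_split_of_dvd_ramificationIdx_holds hC
    finite_support_holds

/-! ### §3.7 without (ii): Theorem 3 for squarefree `P` from Theorem 2 alone -/

section Core

open NumberField IsDedekindDomain

/-- **Clark–Sharif 2010, §3.7 up to the invocation of Cassels' theorem, from Theorem 2 alone.**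
For an elliptic curve `E` over a number field `K`, `P > 1` and `r`: there are an extension `L/K`
of degree `[L : K] = P` and `r` distinct nonzero classes `x ∈ Ш(E_L/L)` whose period divides `P`
and whose index is divisible by `P`. Proof = the printed §3.7 verbatim (as formalised in
`Literature.NumberTheory.EllipticCurves.ClarkSharif2010_thm3_of_parts`), stopping before "(ii)":
`S :=` bad places `∪ {v ∣ P}` `∪` infinite places; `η` from Theorem 2 (`h2`);
`T := ⋃_{1 ≤ i ≤ r} supp(η_i)` (finite, `finite_support_holds`); `L` of degree `P` totally
ramified above `T` (`ClarkSharif2010_exists_totallyRamified_holds`); `η_i|_L ∈ Ш(E_L/L)` — above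
the support by Lang–Tate (`LangTate1958_split_of_dvd_ramificationIdx_holds`: good reduction,
`v ∤ P`, `P = e(w ∣ v)`), elsewhere trivially; `P(η_i|_L) ∣ P(η_i) = P`; every splitting degree
`d` of `η_i|_L` gives the splitting degree `P · d` of `η_i`, divisible by `I(η_i) = P²`, so
`P ∣ d` and `P ∣ I(η_i|_L)` (the index is the gcd of the splitting degrees,
`Literature.NumberTheory.EllipticCurves.dvd_index_of_forall_dvd`); `η_i|_L ≠ 0` and
`η_i|_L ≠ η_j|_L` for `i ≠ j`, since otherwise `P = [L : K]` would be a splitting degree of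
`η_i = η_i - η_0`, resp. of `η_i - η_j`, of index `P² ∤ P`.
[cite: ClarkSharif2010, Theorem 3 and §3.7 (p. 13 of arXiv:0811.3019)] -/
theorem ClarkSharif2010_thm3_core_of_thm2 (h2 : ClarkSharif2010_thm2.{u}) {K : Type u} [Field K]
    [NumberField K] (W : WeierstrassCurve K) [W.IsElliptic] {P : ℕ} (hP : 1 < P) (r : ℕ) :
    ∃ (L : Type u) (_ : Field L) (_ : NumberField L) (_ : Algebra K L),
      Module.finrank K L = P ∧
        ∃ S : Finset ↥((W.baseChange L).sha), S.card = r ∧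
          ∀ x ∈ S, x ≠ 0 ∧ addOrderOf x ∣ P ∧
            P ∣ index (W.baseChange L) (x : (W.baseChange L).galH1) := by
  have hP0 : 0 < P := lt_trans zero_lt_one hP
  -- `S` = bad places ∪ places dividing `P` (finite places), and all infinite places
  have hbad : (W.badPlaces (𝓞 K)).Finite := W.finite_badPlaces_holds (𝓞 K)
  have hPne : Ideal.span {(P : 𝓞 K)} ≠ ⊥ := by
    rw [Ne, Ideal.span_singleton_eq_bot]
    exact_mod_cast hP0.ne'
  have hdiv : {v : HeightOneSpectrum (𝓞 K) | v.asIdeal ∣ Ideal.span {(P : 𝓞 K)}}.Finite :=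
    Ideal.finite_factors hPne
  obtain ⟨η, hη0, hηS, hηT, hηP⟩ := h2 W P hP0 (hbad.toFinset ∪ hdiv.toFinset) Finset.univ
  have hord : ∀ i, 0 < i → addOrderOf (η i) = P := fun i hi ↦ by
    simpa [hη0] using (hηP i 0 hi.ne').1
  have hidx : ∀ i, 0 < i → index W (η i) = P ^ 2 := fun i hi ↦ by
    simpa [hη0] using (hηP i 0 hi.ne').2
  -- `T` = the supports of `η 1, …, η r` (finite: `finite_support_holds`); `L/K` of degree `P`,
  -- totally ramified above `T` (`ClarkSharif2010_exists_totallyRamified_holds`)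
  set T : Finset (HeightOneSpectrum (𝓞 K)) :=
    (Finset.range r).biUnion fun i ↦ (finite_support_holds W (η (i + 1))).toFinset with hTdef
  obtain ⟨L, _, _, _, hdeg, hram⟩ := ClarkSharif2010_exists_totallyRamified_holds T P hP0
  haveI : FiniteDimensional K L := Module.Finite.of_restrictScalars_finite ℚ K L
  haveI : (W.baseChange L).IsElliptic := by rw [WeierstrassCurve.baseChange]; infer_instance
  -- `η i|_L ∈ Ш(E_L/L)` for `1 ≤ i ≤ r` (Lang–Tate above the support, trivially elsewhere)
  have hsha : ∀ i < r, resBaseChange W L (η (i + 1)) ∈ (W.baseChange L).sha := by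
    intro i hi
    rw [WeierstrassCurve.mem_sha_iff]
    refine ⟨fun w ↦ ?_, fun w ↦ ?_⟩
    · by_cases hv : η (i + 1) ∈ W.localRestrictionKer ((w.under (𝓞 K)).adicCompletion K)
      · exact resBaseChange_mem_localRestrictionKer_adic W L w hv
      · set v : HeightOneSpectrum (𝓞 K) := w.under (𝓞 K) with hvdef
        haveI : w.asIdeal.LiesOver v.asIdeal := ⟨rfl⟩
        have hvT : v ∈ T := by
          rw [hTdef, Finset.mem_biUnion]
          exact ⟨i, Finset.mem_range.mpr hi,
            (finite_support_holds W (η (i + 1))).mem_toFinset.mpr hv⟩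
        have hvS : v ∉ hbad.toFinset ∪ hdiv.toFinset := fun h ↦ hv (hηS (i + 1) v h)
        have hgood : W.HasGoodReductionAt v := by
          by_contra h
          exact hvS (Finset.mem_union_left _ (hbad.mem_toFinset.mpr h))
        have hPv : (P : 𝓞 K) ∉ v.asIdeal := fun h ↦
          hvS (Finset.mem_union_right _ (hdiv.mem_toFinset.mpr (Ideal.dvd_span_singleton.mpr h)))
        have hPη : P • η (i + 1) = 0 := by
          rw [← hord (i + 1) i.succ_pos]
          exact addOrderOf_nsmul_eq_zero (η (i + 1))
        exact LangTate1958_split_of_dvd_ramificationIdx_holds W L (η (i + 1)) P hP0 hPη v hgood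
          hPv w ((hram v hvT w).symm ▸ dvd_rfl)
    · exact resBaseChange_mem_localRestrictionKer_infinite W L w
        (hηT (i + 1) _ (Finset.mem_univ _))
  -- the `r` classes `η 1|_L, …, η r|_L`
  let x : Fin r → ↥((W.baseChange L).sha) := fun i ↦ ⟨resBaseChange W L (η (i + 1)), hsha i i.2⟩
  -- `η i|_L ≠ 0`: otherwise `P = [L : K]` would be a splitting degree of `η i`, of index `P²`
  have hxne : ∀ i, x i ≠ 0 := by
    intro i h
    have h0 : resBaseChange W L (η (i + 1)) = 0 := congrArg Subtype.val h
    have hdv := index_dvd_of_mem_splittingDegrees W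
      (finrank_mem_splittingDegrees_of_resBaseChange_eq_zero W L h0)
    rw [hidx (i + 1) (Nat.succ_pos i), hdeg, pow_two] at hdv
    have hle : P * P ≤ P * 1 := by simpa using Nat.le_of_dvd hP0 hdv
    exact absurd (Nat.le_of_mul_le_mul_left hle hP0) (not_le.mpr hP)
  -- `P(η i|_L) ∣ P(η i) = P`
  have hxdvd : ∀ i, addOrderOf (x i) ∣ P := by
    intro i
    rw [← AddSubgroup.addOrderOf_coe]
    change addOrderOf (resBaseChange W L (η (i + 1))) ∣ P
    rw [← hord (i + 1) (Nat.succ_pos i)]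
    exact addOrderOf_map_dvd _ _
  -- `P ∣ I(η i|_L)`: every splitting degree `d` of `η i|_L` gives the splitting degree `P d` of
  -- `η i`, divisible by `I(η i) = P²`
  have hPidx : ∀ i, P ∣ index (W.baseChange L) (x i : (W.baseChange L).galH1) := by
    intro i
    change P ∣ index (W.baseChange L) (resBaseChange W L (η (i + 1)))
    refine dvd_index_of_forall_dvd (W.baseChange L) (splittingDegrees_nonempty _ _) ?_
    intro d hd
    have h := index_dvd_of_mem_splittingDegrees W
      (mul_mem_splittingDegrees_of_mem_resBaseChange W L hd)
    rw [hidx (i + 1) (Nat.succ_pos i), hdeg, pow_two] at h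
    exact Nat.dvd_of_mul_dvd_mul_left hP0 h
  -- the restrictions are distinct: `η i|_L = η j|_L` would make `P` a splitting degree of
  -- `η i - η j`, of index `P²`
  have hxinj : Function.Injective x := by
    intro i j hij
    by_contra hne
    have hne' : (i : ℕ) + 1 ≠ (j : ℕ) + 1 := fun h ↦ hne (Fin.ext (Nat.succ_injective h))
    have h0 : resBaseChange W L (η (i + 1) - η (j + 1)) = 0 := by
      rw [map_sub, sub_eq_zero]
      exact congrArg Subtype.val hij
    have hdv := index_dvd_of_mem_splittingDegrees W
      (finrank_mem_splittingDegrees_of_resBaseChange_eq_zero W L h0)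
    rw [(hηP _ _ hne').2, hdeg, pow_two] at hdv
    have hle : P * P ≤ P * 1 := by simpa using Nat.le_of_dvd hP0 hdv
    exact absurd (Nat.le_of_mul_le_mul_left hle hP0) (not_le.mpr hP)
  refine ⟨L, inferInstance, inferInstance, inferInstance, hdeg, Finset.univ.image x, ?_, ?_⟩
  · rw [Finset.card_image_of_injective _ hxinj, Finset.card_univ, Fintype.card_fin]
  · intro y hy
    obtain ⟨i, -, rfl⟩ := Finset.mem_image.mp hy
    exact ⟨hxne i, hxdvd i, hPidx i⟩

/-- **Clark–Sharif 2010, Theorem 3 over a number field for squarefree `P`, from Theorem 2 alone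
(no Cassels).** For `E/K` elliptic over a number field, `P > 1` squarefree and `r`, there are `L/K`
of degree `P` and `r` distinct elements of `Ш(E_L/L)` of order exactly `P`. From
`ClarkSharif2010_thm3_core_of_thm2`: `P ∣ I(x) ∣ P(x)²`
(`Literature.NumberTheory.EllipticCurves.index_dvd_addOrderOf_sq`, Clark–Sharif §1.3 (1)) and `P`
squarefree give `P ∣ P(x)` (`Squarefree.dvd_pow_iff_dvd`), while `P(x) ∣ P`.
[cite: ClarkSharif2010, Theorem 3, §3.7 and §1.3 eq. (1)] -/
theorem ClarkSharif2010_thm3_numberField_of_thm2_of_squarefree (h2 : ClarkSharif2010_thm2.{u})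
    {K : Type u} [Field K] [NumberField K] (W : WeierstrassCurve K) [W.IsElliptic] {P : ℕ}
    (hP : 1 < P) (hsq : Squarefree P) (r : ℕ) :
    ∃ (L : Type u) (_ : Field L) (_ : NumberField L) (_ : Algebra K L),
      Module.finrank K L = P ∧
        ∃ S : Finset ↥((W.baseChange L).sha), S.card = r ∧ ∀ x ∈ S, addOrderOf x = P := by
  obtain ⟨L, _, _, _, hdeg, S, hS, hx⟩ := ClarkSharif2010_thm3_core_of_thm2 h2 W hP r
  haveI : (W.baseChange L).IsElliptic := by rw [WeierstrassCurve.baseChange]; infer_instance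
  refine ⟨L, inferInstance, inferInstance, inferInstance, hdeg, S, hS, fun x hxS ↦ ?_⟩
  obtain ⟨-, hdvd, hPI⟩ := hx x hxS
  refine Nat.dvd_antisymm hdvd ?_
  rw [← AddSubgroup.addOrderOf_coe]
  exact (hsq.dvd_pow_iff_dvd two_ne_zero).mp
    (hPI.trans (index_dvd_addOrderOf_sq (W.baseChange L) (x : (W.baseChange L).galH1)))

/-- **Clark–Sharif 2010, Theorem 3 over a number field from Theorem 2 and Cassels' `I = P` on
`Ш`** — §3.7 in full, recovered from `ClarkSharif2010_thm3_core_of_thm2` by the single use of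
(ii): `I(x) = P(x)` for `x ∈ Ш(E_L/L)` turns `P ∣ I(x)`, `P(x) ∣ P` into `P(x) = P` ("by (ii)
above, `I(η_i|_L) = P(η_i|_L) ∣ P(η_i) = P`"). (The same statement as
`Literature.NumberTheory.EllipticCurves.ClarkSharif2010_thm3_of_parts'` fed with the discharged
parts; recorded to show where exactly Cassels' theorem is used.)
[cite: ClarkSharif2010, Theorem 3 and §3.7 (ii)] -/
theorem ClarkSharif2010_thm3_numberField_of_thm2_of_cassels (h2 : ClarkSharif2010_thm2.{u})
    (hC : Cassels1962_index_eq_period_of_mem_sha.{u})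
    {K : Type u} [Field K] [NumberField K] (W : WeierstrassCurve K) [W.IsElliptic] {P : ℕ}
    (hP : 1 < P) (r : ℕ) :
    ∃ (L : Type u) (_ : Field L) (_ : NumberField L) (_ : Algebra K L),
      Module.finrank K L = P ∧
        ∃ S : Finset ↥((W.baseChange L).sha), S.card = r ∧ ∀ x ∈ S, addOrderOf x = P := by
  obtain ⟨L, _, _, _, hdeg, S, hS, hx⟩ := ClarkSharif2010_thm3_core_of_thm2 h2 W hP r
  haveI : (W.baseChange L).IsElliptic := by rw [WeierstrassCurve.baseChange]; infer_instance
  refine ⟨L, inferInstance, inferInstance, inferInstance, hdeg, S, hS, fun x hxS ↦ ?_⟩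
  obtain ⟨-, hdvd, hPI⟩ := hx x hxS
  refine Nat.dvd_antisymm hdvd ?_
  rw [← AddSubgroup.addOrderOf_coe, ← hC (W.baseChange L) _ x.2]
  exact hPI

/-- **The barrier statement `ClarkSharif2010_thm3` restricted to squarefree `P`, from
`ClarkSharif2010_thm2` alone**: for every elliptic `E/ℚ`, every squarefree `P > 1` and every `r`
there is a number field `L` with `[L : ℚ] = P` and `r` distinct elements of `Ш(E_L/L)` of order
exactly `P` — the case `K = ℚ` of `ClarkSharif2010_thm3_numberField_of_thm2_of_squarefree`, read
through the canonical `ℚ`-algebra structure of `L` (`Subsingleton (Algebra ℚ L)`), as in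
`ClarkSharif2010_thm3_of_parts`. So for squarefree `P` the only named fact behind the barrier
statement is Theorem 2 of the paper. [cite: ClarkSharif2010, Theorem 3, §3.7 and §1.3 eq. (1)] -/
theorem ClarkSharif2010_thm3_squarefree_of_thm2 (h2 : ClarkSharif2010_thm2.{0})
    (W : WeierstrassCurve ℚ) [W.IsElliptic] {P : ℕ} (hP : 1 < P) (hsq : Squarefree P) (r : ℕ) :
    ∃ (L : Type) (_ : Field L) (_ : NumberField L), Module.finrank ℚ L = P ∧
      ∃ S : Finset ↥((W.baseChange L).sha), S.card = r ∧ ∀ x ∈ S, addOrderOf x = P := by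
  obtain ⟨L, _, _, inst, hdeg, S, hS, hord⟩ :=
    ClarkSharif2010_thm3_numberField_of_thm2_of_squarefree h2 W hP hsq r
  have h : inst = DivisionRing.toRatAlgebra := Subsingleton.elim _ _
  subst h
  exact ⟨L, inferInstance, inferInstance, hdeg, S, hS, hord⟩

/-- **`ClarkSharif2010_thm3` at prime `P`, from `ClarkSharif2010_thm2` alone** (a prime is
squarefree, `ClarkSharif2010_thm3_squarefree_of_thm2`; for prime `P` the divisibility `I ∣ P²` is
not even needed mathematically — a nonzero class of period dividing a prime `P` has period `P` —
but the formal proof goes through the squarefree case).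
[cite: ClarkSharif2010, Theorem 3 and §3.7] -/
theorem ClarkSharif2010_thm3_prime_of_thm2 (h2 : ClarkSharif2010_thm2.{0})
    (W : WeierstrassCurve ℚ) [W.IsElliptic] {P : ℕ} (hP : P.Prime) (r : ℕ) :
    ∃ (L : Type) (_ : Field L) (_ : NumberField L), Module.finrank ℚ L = P ∧
      ∃ S : Finset ↥((W.baseChange L).sha), S.card = r ∧ ∀ x ∈ S, addOrderOf x = P :=
  ClarkSharif2010_thm3_squarefree_of_thm2 h2 W hP.one_lt hP.prime.squarefree r

end Core

end Literature.Barriers.BirchSwinnertonDyer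

end
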